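import Literature.AlgebraicGeometry.Deformation.TrivialDeformationIdealSheaf
import Literature.AlgebraicGeometry.Deformation.BaseChangeKernelIdeal
import HarnessLib

/-!
# `J ⊗_C 𝒪_X ≅ 𝒪_{X₀}` for a principal small extension: the ideal of `X_C ↪ X_{C'}` is `i_*𝒪_{X₀}`
# (Hartshorne, *Deformation Theory*, §6, (6.1) and the proof of Thm. 6.4)

Layer `Literature/AlgebraicGeometry/Deformation` (family `hodge`; literature-typing tranche LT-H1 «semiregularity
consumers», cell `pub-hsemireg`, width seat lit-8 g3; sequel of `TrivialDeformationIdealSheaf.lean` (the case `C' = D`,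
`C = k`) and `BaseChangeKernelIdeal.lean` (`ker i♯ = J · 𝒪`)).

[Hartshorne2010, §6 (6.1), p. 46]: «`0 → J → C' → C → 0` … `J` an ideal with `J² = 0` (or `J𝔪 = 0`) … given `X` flat
over `C` and `X'` flat over `C'` with `X' ×_{C'} C = X`»; proof of Thm. 6.4, p. 50: «the exact sequence
`0 → J ⊗ 𝒪_X → 𝒪_{X'} → 𝒪_X → 0`»; Thm. 6.4 (b): «the group `H¹(J ⊗_C 𝒪_X)` acts». For a PRINCIPAL small extension
(`J = (t)`, `t𝔪 = 0`, Schlessinger Def. 1.2 — the tree's `IsSmallExtension`) `J ≅ k` and `J ⊗_C 𝒪_X = 𝒪_{X₀}`, the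
structure sheaf of the closed fibre: this file identifies, for the TRIVIAL deformations `X_C = X ×_k Spec C`, the ideal
`𝓘` of the first-order thickening `X_C ↪ X_{C'}` with the direct image of `𝒪_{X₀}`, `X₀ = X` the closed fibre of `X_{C'}`.

## What is typed (all PROVED; no named fact, no instance, no notation, no `sorry`)

§ Flatness. `mem_smul_top_of_smul_eq_zero_of_flat` — for a FLAT `A`-module `M` and `t ∈ A` with annihilator `I`
(`t·a = 0 ↔ a ∈ I`): `t·x = 0 ⇒ x ∈ I·M` (Mathlib `Module.Flat.lTensor_exact` on `I ↪ A →ᵗ A`).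

§ FibreParameter (any schemes). For a first-order thickening `i : Y ⟶ Y'`, a morphism `j : Y₀ ⟶ Y'` onto its image
and SPLIT by `r₀` (`j ≫ r₀ = 𝟙`), and `t ∈ Γ(Y', ⊤)` with `i♯ t = 0`:
* `fibreParamMulVal/App`, **`fibreParamMul i j r₀ hr₀ t ht : j_*𝒪_{Y₀} ⟶ 𝓘_i`** (`y ↦ t|_U · r₀♯(y)`, abelian sheaves);
* under (H1) `𝓘_i ⊆ t𝒪` on affine opens, (H2) `t · ker j♯ = 0`, (H3) `ker(t·) ⊆ ker j♯` on affine opens: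
  `fibreParamMulApp_injective` (H3), `fibreParamMulApp_surjective` (H1, H2), **`isIso_fibreParamMul`**
  (`TopCat.Sheaf.isIso_iff_isIso_basis`), **`idealIsoPushforwardFibre : 𝓘_i ≅ j_*𝒪_{Y₀}`**.

§ SmallExtension. For a `k`-scheme `X`, a surjection `p : C' ↠ C` of `Art_k` whose kernel is generated by `t₀` with
`t₀ · 𝔪_{C'} = 0`, `t₀ ≠ 0` (a principal small extension), `i = X_C ↪ X_{C'}` (`(X ◁ Spec p).left`), `j = X ↪ X_{C'}`
(`closedFibreι`), `π : X_{C'} → X`: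
* `isFirstOrderThickening_whiskerLeft_of_ker_eq_span` (`(ker p)² ⊆ (ker p)𝔪 = 0`, file 1);
* `smallExtensionParam X p t₀ : Γ(X_{C'}, ⊤)` (image of `t₀`), `whiskerLeft_appTop_smallExtensionParam` (`i♯ t = 0`, file 4);
* (H1) `exists_eq_sectionOn_mul_of_app_whiskerLeft_eq_zero` (file 4: `ker i♯ = (ker p)·Γ = (t)`),
  (H2) `sectionOn_mul_eq_zero_of_app_closedFibreι_eq_zero` (file 4: `ker j♯ = 𝔪·Γ`, and `t𝔪 = 0`),
  (H3) `app_closedFibreι_eq_zero_of_sectionOn_mul_eq_zero` (flatness of `X_{C'} → Spec C'`, § Flatness, `Ann(t₀) = 𝔪`);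
* **`smallExtensionIdealIso X p … : idealSheafAb (X ◁ Spec p).left ≅ (closedFibreι X C')_* 𝒪_X`** —
  «`J ⊗_C 𝒪_X ≅ 𝒪_{X₀} ⊗_k J ≅ 𝒪_{X₀}`» for the trivial deformation along a principal small extension, so that the
  groups `Hⁿ(𝓘)` of `InvertibleSheafExtensions.lean` become `Hⁿ(X, 𝒪_X)` (via `ThickeningCohomologyTransport`).

HONEST SCOPE. Only the TRIVIAL deformations `X ×_k Spec C` (the tree's carriers); Hartshorne's general flat `X'` over
`C'` is not treated. The isomorphism depends on the chosen generator `t₀` of `J` (as does `J ≅ k`).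

## References

* [Hartshorne2010] R. Hartshorne, *Deformation Theory*, GTM 257, Springer (2010): §6, (6.1) (p. 46), Thm. 6.4 and proof
  (pp. 50–51); §2 Prop. 2.2 (p. 9).
* [Schlessinger1968] M. Schlessinger, Functors of Artin rings, Trans. AMS 130 (1968), Def. 1.2 (small extensions).
* [StacksProject] The Stacks Project, Tag 00HL (flatness: `I ⊗ M → M`), Tag 08KY.
-/

noncomputable section

-- `(X ⊗ T).left = pullback X.hom T.hom` is `rfl` (`Over.tensorObj_left`) only at default transparency; as in Mathlib's
set_option backward.isDefEq.respectTransparency false -- `CategoryTheory.Monoidal.Cartesian.Over` itself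

open CategoryTheory Limits Opposite TopologicalSpace MonoidalCategory TensorProduct _root_.AlgebraicGeometry

universe u v

namespace Literature.AlgebraicGeometry.Deformation

/-! ### Flatness: `ker(t·) = Ann(t) · M` -/

section Flatness

/-- **For a flat module `M` and `t ∈ A` with annihilator `I`: `t·x = 0 ⇒ x ∈ I·M`** (tensor the exact sequence
`I ↪ A →ᵗ A` with `M`). [cite: StacksProject, Tag 00HL] [cite: Hartshorne2010, §2 Prop. 2.2, p. 9] -/
theorem mem_smul_top_of_smul_eq_zero_of_flat {A : Type u} [CommRing A] {M : Type v} [AddCommGroup M] [Module A M]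
    [Module.Flat A M] (I : Ideal A) (t : A) (hann : ∀ a : A, t * a = 0 ↔ a ∈ I) {x : M} (hx : t • x = 0) :
    x ∈ I • (⊤ : Submodule A M) := by
  have hex : Function.Exact (Submodule.subtype I) (LinearMap.lsmul A A t) := by
    intro a
    constructor
    · intro h
      exact ⟨⟨a, (hann a).mp h⟩, rfl⟩
    · rintro ⟨b, rfl⟩
      exact (hann b).mpr b.2
  have hT := Module.Flat.lTensor_exact M hex
  have h1 : (LinearMap.lsmul A A t).lTensor M (x ⊗ₜ[A] (1 : A)) = 0 := by
    rw [LinearMap.lTensor_tmul, LinearMap.lsmul_apply, smul_eq_mul, mul_one, ← mul_one t, ← smul_eq_mul,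
      ← TensorProduct.smul_tmul, hx, TensorProduct.zero_tmul]
  obtain ⟨w, hw⟩ := (hT _).mp h1
  have key : ∀ w : M ⊗[A] I, TensorProduct.rid A M ((Submodule.subtype I).lTensor M w) ∈ I • (⊤ : Submodule A M) := by
    intro w
    induction w using TensorProduct.induction_on with
    | zero => rw [map_zero, map_zero]; exact Submodule.zero_mem _
    | tmul m a =>
      rw [LinearMap.lTensor_tmul, TensorProduct.rid_tmul]
      exact Submodule.smul_mem_smul a.2 Submodule.mem_top
    | add w₁ w₂ h₁ h₂ => rw [map_add, map_add]; exact Submodule.add_mem _ h₁ h₂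
  have hxw := key w
  rw [hw, TensorProduct.rid_tmul, one_smul] at hxw
  exact hxw

end Flatness

/-! ### A thickening `i`, a split closed fibre `j`, and a parameter `t`: `j_*𝒪_{Y₀} ⟶ 𝓘_i`, `y ↦ t · r₀♯(y)` -/

section FibreParameter

variable {Y Y' Y₀ : Scheme.{u}} (i : Y ⟶ Y') (j : Y₀ ⟶ Y') (r₀ : Y' ⟶ Y₀) (hr₀ : j ≫ r₀ = 𝟙 Y₀) [Surjective j]
  (t : Γ(Y', ⊤))

/-- `t|_U · r₀♯(y) ∈ Γ(Y', U)` for `y ∈ Γ(Y₀, j⁻¹U)`. [cite: Hartshorne2010, §6 proof of Thm. 6.4, p. 50 («`J ⊗ 𝒪_X → 𝒪_{X'}`»)] -/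
def fibreParamMulVal (U : Y'.Opens) (y : Γ(Y₀, j ⁻¹ᵁ U)) : Γ(Y', U) :=
  sectionOn t U * retractionApp j r₀ hr₀ U y

/-- [cite: Hartshorne2010, §6 proof of Thm. 6.4, p. 50] -/
theorem fibreParamMulVal_def (U : Y'.Opens) (y : Γ(Y₀, j ⁻¹ᵁ U)) :
    fibreParamMulVal j r₀ hr₀ t U y = sectionOn t U * retractionApp j r₀ hr₀ U y := rfl

/-- `i♯ (t · r₀♯ y) = 0` when `i♯ t = 0`. [cite: Hartshorne2010, §6 proof of Thm. 6.4, p. 50] -/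
theorem app_fibreParamMulVal (ht : i.appTop t = 0) (U : Y'.Opens) (y : Γ(Y₀, j ⁻¹ᵁ U)) :
    i.app U (fibreParamMulVal j r₀ hr₀ t U y) = 0 := by
  rw [fibreParamMulVal_def, map_mul, app_sectionOn i t ht U, zero_mul]

/-- [cite: Hartshorne2010, §6 proof of Thm. 6.4, p. 50] -/
theorem fibreParamMulVal_add (U : Y'.Opens) (y z : Γ(Y₀, j ⁻¹ᵁ U)) :
    fibreParamMulVal j r₀ hr₀ t U (y + z) = fibreParamMulVal j r₀ hr₀ t U y + fibreParamMulVal j r₀ hr₀ t U z := by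
  rw [fibreParamMulVal_def, fibreParamMulVal_def, fibreParamMulVal_def, map_add, mul_add]

/-- [cite: Hartshorne2010, §6 proof of Thm. 6.4, p. 50] -/
theorem fibreParamMulVal_zero (U : Y'.Opens) : fibreParamMulVal j r₀ hr₀ t U 0 = 0 := by
  rw [fibreParamMulVal_def, map_zero, mul_zero]

/-- Compatibility with restriction. [cite: Hartshorne2010, §6 proof of Thm. 6.4, p. 50] -/
theorem map_fibreParamMulVal {U V : Y'.Opens} (f : op U ⟶ op V) (y : Γ(Y₀, j ⁻¹ᵁ U)) :
    Y'.presheaf.map f (fibreParamMulVal j r₀ hr₀ t U y) =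
      fibreParamMulVal j r₀ hr₀ t V (Y₀.presheaf.map ((Opens.map j.base).map f.unop).op y) := by
  rw [fibreParamMulVal_def, fibreParamMulVal_def, map_mul, ← CommRingCat.comp_apply, ← map_retractionApp j r₀ hr₀ f,
    CommRingCat.comp_apply]
  congr 1
  exact map_sectionOn t f.unop.le

/-- `y ↦ t · r₀♯(y)` as an additive map `Γ(Y₀, j⁻¹U) → 𝓘_i(U)`. [cite: Hartshorne2010, §6 proof of Thm. 6.4, p. 50] -/
def fibreParamMulApp (ht : i.appTop t = 0) (U : Y'.Opens) : Γ(Y₀, j ⁻¹ᵁ U) →+ (idealSheafAb i).obj.obj (op U) where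
  toFun y := idealLift i U (fibreParamMulVal j r₀ hr₀ t U y) (app_fibreParamMulVal i j r₀ hr₀ t ht U y)
  map_zero' := idealVal_injective i U (by rw [idealVal_idealLift, fibreParamMulVal_zero, idealVal_zero])
  map_add' y z := idealVal_injective i U (by
    rw [idealVal_idealLift, idealVal_add, idealVal_idealLift, idealVal_idealLift, fibreParamMulVal_add])

/-- The value of `fibreParamMulApp y` is `t|_U · r₀♯ y`. [cite: Hartshorne2010, §6 proof of Thm. 6.4, p. 50] -/
@[simp]
theorem idealVal_fibreParamMulApp (ht : i.appTop t = 0) (U : Y'.Opens) (y : Γ(Y₀, j ⁻¹ᵁ U)) :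
    idealVal i U (fibreParamMulApp i j r₀ hr₀ t ht U y) = sectionOn t U * retractionApp j r₀ hr₀ U y :=
  idealVal_idealLift i U _ (app_fibreParamMulVal i j r₀ hr₀ t ht U y)

/-- **The morphism of abelian sheaves `j_*𝒪_{Y₀} ⟶ 𝓘_i`, `y ↦ t · r₀♯(y)`** («`J ⊗ 𝒪_X → 𝒪_{X'}`», landing in the
ideal of `i`). [cite: Hartshorne2010, §6 proof of Thm. 6.4, p. 50 («the exact sequence `0 → J ⊗ 𝒪_X → 𝒪_{X'} → 𝒪_X → 0`»)] -/
def fibreParamMul (ht : i.appTop t = 0) :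
    (TopCat.Sheaf.pushforward AddCommGrpCat.{u} j.base).obj (Motives.structureSheafAb Y₀) ⟶ idealSheafAb i :=
  ObjectProperty.homMk
    { app := fun U => AddCommGrpCat.ofHom (fibreParamMulApp i j r₀ hr₀ t ht U.unop)
      naturality := fun U V f => by
        refine AddCommGrpCat.hom_ext (AddMonoidHom.ext fun y => ?_)
        apply idealVal_injective i V.unop
        change idealVal i V.unop
            (fibreParamMulApp i j r₀ hr₀ t ht V.unop (Y₀.presheaf.map ((Opens.map j.base).map f.unop).op y)) =
          idealVal i V.unop (((idealSheafAb i).obj.map f).hom (fibreParamMulApp i j r₀ hr₀ t ht U.unop y))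
        have e := secRes_idealVal i f.unop.le (fibreParamMulApp i j r₀ hr₀ t ht U.unop y)
        rw [idealVal_fibreParamMulApp] at e
        rw [idealVal_fibreParamMulApp, ← fibreParamMulVal_def, ← map_fibreParamMulVal, fibreParamMulVal_def]
        exact e }

/-- [cite: Hartshorne2010, §6 proof of Thm. 6.4, p. 50] -/
theorem fibreParamMul_app_apply (ht : i.appTop t = 0) (U : Y'.Opens) (y : Γ(Y₀, j ⁻¹ᵁ U)) :
    ((fibreParamMul i j r₀ hr₀ t ht).hom.app (op U)).hom y = fibreParamMulApp i j r₀ hr₀ t ht U y := rfl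

/-- **Injectivity on an affine open** under (H3) `ker(t·) ⊆ ker j♯`: `t · r₀♯ y = 0 ⇒ j♯(r₀♯ y) = y = 0`.
[cite: Hartshorne2010, §6 proof of Thm. 6.4, p. 50 («`0 → J ⊗ 𝒪_X → 𝒪_{X'}`» exact)] -/
theorem fibreParamMulApp_injective (ht : i.appTop t = 0) (U : Y'.affineOpens)
    (hjt : ∀ b : Γ(Y', U.1), sectionOn t U.1 * b = 0 → j.app U.1 b = 0) :
    Function.Injective (fibreParamMulApp i j r₀ hr₀ t ht U.1) := by
  refine (injective_iff_map_eq_zero _).mpr fun y hy => ?_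
  have h : sectionOn t U.1 * retractionApp j r₀ hr₀ U.1 y = 0 := by
    rw [← idealVal_fibreParamMulApp i j r₀ hr₀ t ht, hy, idealVal_zero]
  rw [← app_retractionApp j r₀ hr₀ U.1 y]
  exact hjt _ h

/-- **Surjectivity onto `𝓘_i(U)` on an affine open** under (H1) `𝓘_i ⊆ t𝒪` and (H2) `t · ker j♯ = 0`: for
`a = t·b ∈ 𝓘_i(U)`, `t·b = t·r₀♯(j♯ b)` since `r₀♯(j♯ b) - b ∈ ker j♯`.
[cite: Hartshorne2010, §6 proof of Thm. 6.4, p. 50 («`J ⊗ 𝒪_X → 𝒪_{X'} → 𝒪_X` exact»)] -/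
theorem fibreParamMulApp_surjective (ht : i.appTop t = 0) (U : Y'.affineOpens)
    (hI : ∀ a : Γ(Y', U.1), i.app U.1 a = 0 → ∃ b, a = sectionOn t U.1 * b)
    (htj : ∀ b : Γ(Y', U.1), j.app U.1 b = 0 → sectionOn t U.1 * b = 0) :
    Function.Surjective (fibreParamMulApp i j r₀ hr₀ t ht U.1) := by
  intro x
  obtain ⟨b, hb⟩ := hI (idealVal i U.1 x) (app_idealVal i U.1 x)
  refine ⟨j.app U.1 b, idealVal_injective i U.1 ?_⟩
  have hdiff : j.app U.1 (retractionApp j r₀ hr₀ U.1 (j.app U.1 b) - b) = 0 := by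
    rw [map_sub, app_retractionApp, sub_self]
  have hzero := htj _ hdiff
  rw [mul_sub, sub_eq_zero] at hzero
  rw [idealVal_fibreParamMulApp, hzero, ← hb]

/-- **`j_*𝒪_{Y₀} ⟶ 𝓘_i` is an isomorphism** under (H1)–(H3) on affine opens (Mathlib `TopCat.Sheaf.isIso_iff_isIso_basis`).
[cite: Hartshorne2010, §6 proof of Thm. 6.4, p. 50 («`0 → J ⊗ 𝒪_X → 𝒪_{X'} → 𝒪_X → 0`»)] -/
theorem isIso_fibreParamMul (ht : i.appTop t = 0)
    (hI : ∀ (U : Y'.affineOpens) (a : Γ(Y', U.1)), i.app U.1 a = 0 → ∃ b, a = sectionOn t U.1 * b)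
    (htj : ∀ (U : Y'.affineOpens) (b : Γ(Y', U.1)), j.app U.1 b = 0 → sectionOn t U.1 * b = 0)
    (hjt : ∀ (U : Y'.affineOpens) (b : Γ(Y', U.1)), sectionOn t U.1 * b = 0 → j.app U.1 b = 0) :
    IsIso (fibreParamMul i j r₀ hr₀ t ht) := by
  have hB : Opens.IsBasis (Set.range ((↑) : Y'.affineOpens → Y'.Opens)) := by
    rw [Subtype.range_coe]
    exact Y'.isBasis_affineOpens
  refine TopCat.Sheaf.isIso_iff_isIso_basis (B := ((↑) : Y'.affineOpens → Y'.Opens)) hB (fun U => ?_)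
  exact (ConcreteCategory.isIso_iff_bijective _).mpr
    ⟨fibreParamMulApp_injective i j r₀ hr₀ t ht U (hjt U), fibreParamMulApp_surjective i j r₀ hr₀ t ht U (hI U) (htj U)⟩

/-- **`𝓘_i ≅ j_*𝒪_{Y₀}`** under (H1)–(H3) (inverse of `fibreParamMul`). [cite: Hartshorne2010, §6 proof of Thm. 6.4,
p. 50 («`0 → J ⊗ 𝒪_X → 𝒪_{X'} → 𝒪_X → 0`»)] -/
def idealIsoPushforwardFibre (ht : i.appTop t = 0)
    (hI : ∀ (U : Y'.affineOpens) (a : Γ(Y', U.1)), i.app U.1 a = 0 → ∃ b, a = sectionOn t U.1 * b)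
    (htj : ∀ (U : Y'.affineOpens) (b : Γ(Y', U.1)), j.app U.1 b = 0 → sectionOn t U.1 * b = 0)
    (hjt : ∀ (U : Y'.affineOpens) (b : Γ(Y', U.1)), sectionOn t U.1 * b = 0 → j.app U.1 b = 0) :
    idealSheafAb i ≅ (TopCat.Sheaf.pushforward AddCommGrpCat.{u} j.base).obj (Motives.structureSheafAb Y₀) :=
  haveI := isIso_fibreParamMul i j r₀ hr₀ t ht hI htj hjt
  (asIso (fibreParamMul i j r₀ hr₀ t ht)).symm

/-- [cite: Hartshorne2010, §6 proof of Thm. 6.4, p. 50] -/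
theorem idealIsoPushforwardFibre_inv (ht : i.appTop t = 0)
    (hI : ∀ (U : Y'.affineOpens) (a : Γ(Y', U.1)), i.app U.1 a = 0 → ∃ b, a = sectionOn t U.1 * b)
    (htj : ∀ (U : Y'.affineOpens) (b : Γ(Y', U.1)), j.app U.1 b = 0 → sectionOn t U.1 * b = 0)
    (hjt : ∀ (U : Y'.affineOpens) (b : Γ(Y', U.1)), sectionOn t U.1 * b = 0 → j.app U.1 b = 0) :
    (idealIsoPushforwardFibre i j r₀ hr₀ t ht hI htj hjt).inv = fibreParamMul i j r₀ hr₀ t ht := rfl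

end FibreParameter

/-! ### The trivial deformation along a principal small extension `C' ↠ C` -/

section SmallExtension

open IsLocalRing

variable {k : Type u} [Field k] (X : Motives.SchemeOver k) {C' C : ArtAlg.{u} k} (p : C' →ₐ[k] C)
  (hp : Function.Surjective p) (t₀ : C') (hker : RingHom.ker p.toRingHom = Ideal.span {t₀})
  (htm : ∀ m ∈ maximalIdeal (C' : Type u), t₀ * m = 0) (ht₀ : t₀ ≠ 0)

/-- The kernel of a morphism of `Art_k` lies in the maximal ideal. [cite: Schlessinger1968, Def. 1.2] -/
theorem ker_le_maximalIdeal_artAlg : RingHom.ker p.toRingHom ≤ maximalIdeal (C' : Type u) := by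
  refine IsLocalRing.le_maximalIdeal fun h => ?_
  have h1 : (1 : (C' : Type u)) ∈ RingHom.ker p.toRingHom := by rw [h]; trivial
  rw [RingHom.mem_ker, map_one] at h1
  exact one_ne_zero h1

include htm hker in
/-- `(ker p)² = 0` for a principal small extension (`(ker p) · 𝔪 = 0`, `ker p ⊆ 𝔪`). [cite: Schlessinger1968, Def. 1.2] -/
theorem ker_mul_ker_eq_bot_of_ker_eq_span : RingHom.ker p.toRingHom * RingHom.ker p.toRingHom = ⊥ := by
  refine le_bot_iff.mp (Ideal.mul_le.mpr fun a ha b hb => ?_)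
  rw [hker] at ha
  obtain ⟨c, rfl⟩ := Ideal.mem_span_singleton'.mp ha
  rw [Ideal.mem_bot, mul_assoc, htm b (ker_le_maximalIdeal_artAlg p hb), mul_zero]

include hp htm hker in
/-- **`X_C ↪ X_{C'}` is a first-order thickening** for a principal small extension (file 1).
[cite: Hartshorne2010, §6 (6.1), p. 46 («`J² = 0` (or `J𝔪 = 0`)»)] -/
theorem isFirstOrderThickening_whiskerLeft_of_ker_eq_span :
    IsFirstOrderThickening (X ◁ ArtAlg.specOverMap p).left :=
  isFirstOrderThickening_whiskerLeft_specOverMap X p hp (ker_mul_ker_eq_bot_of_ker_eq_span p t₀ hker htm)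

/-- **The parameter `t ∈ Γ(X_{C'}, ⊤)`**: the image of the generator `t₀` of `J = ker p` under the structure map.
[cite: Hartshorne2010, §6 proof of Thm. 6.4, p. 50 («`J ⊗ 𝒪_X`»)] -/
def smallExtensionParam : Γ((X ⊗ C'.specOver).left, ⊤) :=
  specStructureMap (pullback.snd X.hom C'.specOver.hom) t₀

/-- [cite: Hartshorne2010, §6 proof of Thm. 6.4, p. 50] -/
theorem smallExtensionParam_def :
    smallExtensionParam X t₀ = specStructureMap (pullback.snd X.hom C'.specOver.hom) t₀ := rfl

include hker in
/-- `i♯ t = 0` for `i : X_C ↪ X_{C'}` (`p t₀ = 0`). [cite: Hartshorne2010, §6 proof of Thm. 6.4, p. 50] -/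
theorem whiskerLeft_appTop_smallExtensionParam :
    (X ◁ ArtAlg.specOverMap p).left.appTop (smallExtensionParam X t₀) = 0 := by
  have h0 : p.toRingHom t₀ = 0 := by
    rw [← RingHom.mem_ker, hker]
    exact Ideal.mem_span_singleton_self t₀
  exact appTop_specStructureMap_eq_zero p.toRingHom (pullback.snd X.hom C'.specOver.hom)
    (isPullback_whiskerLeft_specOverMap X p).w h0

/-- The structure map `C' → Γ(X_{C'}, U)` on an open `U`. [cite: Hartshorne2010, §6 (6.1), p. 46] -/
def secStructureMap (U : (X ⊗ C'.specOver).left.Opens) : (C' : Type u) →+* Γ((X ⊗ C'.specOver).left, U) :=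
  ((X ⊗ C'.specOver).left.presheaf.map (homOfLE (le_top : U ≤ ⊤)).op).hom.comp
    (specStructureMap (pullback.snd X.hom C'.specOver.hom))

/-- [cite: Hartshorne2010, §6 (6.1), p. 46] -/
theorem secStructureMap_apply (U : (X ⊗ C'.specOver).left.Opens) (c : (C' : Type u)) :
    secStructureMap X U c = (X ⊗ C'.specOver).left.presheaf.map (homOfLE (le_top : U ≤ ⊤)).op
      (specStructureMap (pullback.snd X.hom C'.specOver.hom) c) := rfl

/-- `t|_U` is the image of `t₀` under the structure map on `U`. [cite: Hartshorne2010, §6 proof of Thm. 6.4, p. 50] -/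
theorem secStructureMap_generator (U : (X ⊗ C'.specOver).left.Opens) :
    secStructureMap X U t₀ = sectionOn (smallExtensionParam X t₀) U := rfl

include hp hker in
/-- **(H1) `𝓘_i(U) = t · Γ(X_{C'}, U)` on affine `U`** (file 4: `ker i♯ = (ker p) · Γ`, `ker p = (t₀)`).
[cite: Hartshorne2010, §6 proof of Thm. 6.4, p. 50] -/
theorem exists_eq_sectionOn_mul_of_app_whiskerLeft_eq_zero (U : (X ⊗ C'.specOver).left.affineOpens)
    (a : Γ((X ⊗ C'.specOver).left, U.1)) (ha : (X ◁ ArtAlg.specOverMap p).left.app U.1 a = 0) :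
    ∃ b, a = sectionOn (smallExtensionParam X t₀) U.1 * b := by
  have hmem : a ∈ RingHom.ker ((X ◁ ArtAlg.specOverMap p).left.app U.1).hom := ha
  rw [ker_app_eq_map_of_isPullback p.toRingHom hp (isPullback_whiskerLeft_specOverMap X p) U, hker, Ideal.map_span,
    Set.image_singleton] at hmem
  obtain ⟨b, hb⟩ := Ideal.mem_span_singleton'.mp hmem
  exact ⟨b, by rw [← hb, mul_comm]; rfl⟩

include htm in
/-- **(H2) `t · ker j♯ = 0`** for the closed fibre `j : X ↪ X_{C'}` (file 4: `ker j♯ = 𝔪 · Γ`, and `t₀ 𝔪 = 0`).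
[cite: Hartshorne2010, §6 (6.1), p. 46 («`J𝔪 = 0`»)] -/
theorem sectionOn_mul_eq_zero_of_app_closedFibreι_eq_zero (U : (X ⊗ C'.specOver).left.affineOpens)
    (b : Γ((X ⊗ C'.specOver).left, U.1)) (hb : (closedFibreι X C').app U.1 b = 0) :
    sectionOn (smallExtensionParam X t₀) U.1 * b = 0 := by
  have hmem : b ∈ RingHom.ker ((closedFibreι X C').app U.1).hom := hb
  rw [ker_app_closedFibreι X C' U] at hmem
  change b ∈ Ideal.map (secStructureMap X U.1) (maximalIdeal (C' : Type u)) at hmem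
  rw [← secStructureMap_generator]
  refine Submodule.span_induction (p := fun b _ => secStructureMap X U.1 t₀ * b = 0) ?_ ?_ ?_ ?_ hmem
  · rintro _ ⟨m, hm, rfl⟩
    rw [← map_mul, htm m hm, map_zero]
  · exact mul_zero _
  · intro x y _ _ hx hy
    rw [mul_add, hx, hy, add_zero]
  · intro c x _ hx
    rw [smul_eq_mul, mul_left_comm, hx, mul_zero]

include htm ht₀ in
/-- The annihilator of `t₀` is the maximal ideal (`t₀ 𝔪 = 0`, `t₀ ≠ 0`, `C'` local). [cite: Schlessinger1968, Def. 1.2] -/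
theorem mul_eq_zero_iff_mem_maximalIdeal (a : (C' : Type u)) : t₀ * a = 0 ↔ a ∈ maximalIdeal (C' : Type u) := by
  refine ⟨fun h => ?_, fun h => htm a h⟩
  by_contra hna
  have hu : IsUnit a := by
    by_contra hu
    exact hna ((IsLocalRing.mem_maximalIdeal a).mpr hu)
  exact ht₀ (by rw [← mul_one t₀, ← hu.mul_val_inv, ← mul_assoc, h, zero_mul])

include htm ht₀ in
/-- **(H3) `ker(t·) ⊆ ker j♯` on affine `U`**: `Γ(X_{C'}, U)` is FLAT over `C'` (base change of `X → Spec k`), so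
`t·b = 0 ⇒ b ∈ 𝔪 · Γ(X_{C'}, U) = ker j♯` (§ Flatness + file 4). [cite: Hartshorne2010, §2 Prop. 2.2, p. 9]
[cite: Hartshorne2010, §6 (6.1), p. 46 («`X'` flat over `C'`»)] -/
theorem app_closedFibreι_eq_zero_of_sectionOn_mul_eq_zero (U : (X ⊗ C'.specOver).left.affineOpens)
    (b : Γ((X ⊗ C'.specOver).left, U.1)) (hb : sectionOn (smallExtensionParam X t₀) U.1 * b = 0) :
    (closedFibreι X C').app U.1 b = 0 := by
  haveI := flat_pullback_snd_specOver X C'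
  haveI : IsAffine C'.specOver.left := inferInstanceAs (IsAffine (Spec _))
  have hψ := (pullback.snd X.hom C'.specOver.hom).flat_appLE (isAffineOpen_top _) U.2 (le_top : U.1 ≤ _)
  have hψ' : (((pullback.snd X.hom C'.specOver.hom).appLE ⊤ U.1 le_top).hom.comp
      (Scheme.ΓSpecIso (.of (C' : Type u))).inv.hom).Flat :=
    RingHom.Flat.comp (RingHom.Flat.of_bijective
      (ConcreteCategory.bijective_of_isIso (Scheme.ΓSpecIso (.of (C' : Type u))).inv)) hψ
  have heq : secStructureMap X U.1 = ((pullback.snd X.hom C'.specOver.hom).appLE ⊤ U.1 le_top).hom.comp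
      (Scheme.ΓSpecIso (.of (C' : Type u))).inv.hom := RingHom.ext fun c => rfl
  rw [← heq] at hψ'
  letI := (secStructureMap X U.1).toAlgebra
  haveI : Module.Flat (C' : Type u) Γ((X ⊗ C'.specOver).left, U.1) := hψ'
  have hsmul : t₀ • b = 0 := by
    rw [Algebra.smul_def]
    exact hb
  have hmem := mem_smul_top_of_smul_eq_zero_of_flat (maximalIdeal (C' : Type u)) t₀
    (mul_eq_zero_iff_mem_maximalIdeal t₀ htm ht₀) hsmul
  rw [Ideal.smul_top_eq_map, Submodule.restrictScalars_mem] at hmem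
  change b ∈ RingHom.ker ((closedFibreι X C').app U.1).hom
  rw [ker_app_closedFibreι X C' U]
  exact hmem

include hp hker htm ht₀ in
/-- **`J ⊗_C 𝒪_X ≅ 𝒪_{X₀}`: the ideal of `X_C ↪ X_{C'}` along a principal small extension is `j_*𝒪_X`**, `j : X ↪ X_{C'}`
the closed fibre (inverse of `y ↦ t · π♯(y)`); with it the groups `Hⁿ(𝓘)` of `InvertibleSheafExtensions.lean` are
`Hⁿ(X, 𝒪_X)` (`ThickeningCohomologyTransport`). [cite: Hartshorne2010, §6 Thm. 6.4 and proof, pp. 50–51 («`0 → J ⊗ 𝒪_X →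
𝒪_{X'} → 𝒪_X → 0`», «the group `H¹(J ⊗_C 𝒪_X)` acts»)] [cite: Hartshorne2010, §6 (6.1), p. 46] -/
def smallExtensionIdealIso :
    idealSheafAb (X ◁ ArtAlg.specOverMap p).left ≅
      (TopCat.Sheaf.pushforward AddCommGrpCat.{u} (closedFibreι X C').base).obj (Motives.structureSheafAb X.left) :=
  haveI := surjective_closedFibreι X C'
  idealIsoPushforwardFibre (X ◁ ArtAlg.specOverMap p).left (closedFibreι X C') (pullback.fst X.hom C'.specOver.hom)
    (closedFibreι_fst X C') (smallExtensionParam X t₀) (whiskerLeft_appTop_smallExtensionParam X p t₀ hker)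
    (fun U a ha => exists_eq_sectionOn_mul_of_app_whiskerLeft_eq_zero X p hp t₀ hker U a ha)
    (fun U b hb => sectionOn_mul_eq_zero_of_app_closedFibreι_eq_zero X t₀ htm U b hb)
    (fun U b hb => app_closedFibreι_eq_zero_of_sectionOn_mul_eq_zero X t₀ htm ht₀ U b hb)

include hp hker htm ht₀ in
/-- The inverse of `smallExtensionIdealIso` is `y ↦ t · π♯(y)` (`fibreParamMul`). [cite: Hartshorne2010, §6 proof of
Thm. 6.4, p. 50] -/
theorem smallExtensionIdealIso_inv :
    (smallExtensionIdealIso X p hp t₀ hker htm ht₀).inv =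
      haveI := surjective_closedFibreι X C'
      fibreParamMul (X ◁ ArtAlg.specOverMap p).left (closedFibreι X C') (pullback.fst X.hom C'.specOver.hom)
        (closedFibreι_fst X C') (smallExtensionParam X t₀) (whiskerLeft_appTop_smallExtensionParam X p t₀ hker) := rfl

end SmallExtension

end Literature.AlgebraicGeometry.Deformation

end
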